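import Mathlib
import Literature.NumberTheory.Transcendental.KZIdealTetrahedron
import HarnessLib

/-!
# The volume of the ideal tetrahedron `T(∞, 0, 1, z)` as an iterated integral (Tonelli)

Support file for the discharge of `Milnor1982_idealTetrahedronVolume` (Milnor 1982, Lemma 2).
Theorems only.

Write `z = a + bi` with `b > 0`, `k = (|z|² − a)/b`, and `H(x, y) = x − x² − y² + k y`, so that
the hemisphere through `0, 1, z` (the face of `T(z)` opposite to `∞`) is `t² = H(x, y)` and the
open triangle `(0, 1, z)` is `{0 < y < b, a y / b < x < 1 + (a − 1) y / b}`. Following the first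
step of Milnor's proof of Lemma 2 (Milnor 1982, p. 19: "Integrating with respect to z, we obtain
`½ dx dy / (1 − x² − y²)`"), we prove, by Tonelli on `ℝ³ = Fin 3 → ℝ` (Mathlib's `lmarginal`):

* `height_pos` — `H > 0` over the triangle (closed slices): `b² H` is a positive combination of the
  barycentric coordinates (`mul_height_eq`);
* `lintegral_Ioi_sqrt_one_div_cube` — `∫_{t > √H} t⁻³ dt = 1/(2H)`;
* `idealTetrahedronVolume_eq_lintegral_slice` — for `Im z > 0`,
  `vol T(z) = (∫⁻_{y ∈ (0,b)} ∫_{a y/b}^{1+(a−1)y/b} dx / (2 H(x,y)) dy).toReal`,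
  the inner integral being an honest interval integral of a continuous positive function.

## References

* J. Milnor, *Hyperbolic geometry: the first 150 years*, Bull. AMS (N.S.) 6 (1982) 9–24:
  Appendix, proof of Lemma 2, pp. 19–20. [`Milnor1982`]
-/

noncomputable section

open MeasureTheory Set
open scoped ENNReal

namespace Literature.NumberTheory.Transcendental

/-! ### The hemisphere lies above the triangle: `H > 0` -/

/-- `b²·H` as a combination of the barycentric coordinates `λ₂ = y/b`, `λ₁ = (bx − ay)/b`,
`λ₀ = ((a−1)y − b(x−1))/b` of `(x, y)` in the triangle `(0, 1, a+bi)`: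
`b² H = λ₀λ₁ b² + λ₀λ₂ b²|z|² + λ₁λ₂ b² |z − 1|²`. [folklore] -/
theorem mul_height_eq (a b x y : ℝ) :
    b * (b * (x - x ^ 2 - y ^ 2) + (a ^ 2 + b ^ 2 - a) * y) =
      ((a - 1) * y - b * (x - 1)) * (b * x - a * y) +
        ((a - 1) * y - b * (x - 1)) * y * (a ^ 2 + b ^ 2) +
        (b * x - a * y) * y * ((a - 1) ^ 2 + b ^ 2) := by
  ring

/-- Over the triangle `(0, 1, z)` (closed horizontal slices at height `0 < y < b`) the hemisphere
through `0, 1, z` has positive height: `b·H > 0`. [cite: Milnor1982, Appendix, proof of Lemma 2,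
p. 19] -/
theorem mul_height_pos {a b x y : ℝ} (hb : 0 < b) (hy : 0 < y) (h2 : a * y ≤ b * x)
    (h3 : b * (x - 1) ≤ (a - 1) * y) (hyb : y < b) :
    0 < b * (x - x ^ 2 - y ^ 2) + (a ^ 2 + b ^ 2 - a) * y := by
  have hP2 : 0 ≤ b * x - a * y := by linarith
  have hP3 : 0 ≤ (a - 1) * y - b * (x - 1) := by linarith
  have hz : 0 < a ^ 2 + b ^ 2 := by positivity
  have hz1 : 0 < (a - 1) ^ 2 + b ^ 2 := by positivity
  have hbH : 0 < b * (b * (x - x ^ 2 - y ^ 2) + (a ^ 2 + b ^ 2 - a) * y) := by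
    rw [mul_height_eq]
    have h1 : 0 ≤ ((a - 1) * y - b * (x - 1)) * (b * x - a * y) := mul_nonneg hP3 hP2
    have h2' : 0 ≤ ((a - 1) * y - b * (x - 1)) * y * (a ^ 2 + b ^ 2) := by positivity
    have h3' : 0 ≤ (b * x - a * y) * y * ((a - 1) ^ 2 + b ^ 2) := by positivity
    rcases lt_or_ge 0 (b * x - a * y) with hP2' | hP2'
    · have : 0 < (b * x - a * y) * y * ((a - 1) ^ 2 + b ^ 2) := by positivity
      linarith
    · have hP3' : 0 < (a - 1) * y - b * (x - 1) := by linarith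
      have : 0 < ((a - 1) * y - b * (x - 1)) * y * (a ^ 2 + b ^ 2) := by positivity
      linarith
  exact pos_of_mul_pos_right hbH hb.le

/-- The same with `k = (a² + b² − a)/b`: `H(x, y) = x − x² − y² + k y > 0` on the closed slices
of the open triangle. [cite: Milnor1982, Appendix, proof of Lemma 2, p. 19] -/
theorem height_pos {a b k x y : ℝ} (hb : 0 < b) (hk : b * k = a ^ 2 + b ^ 2 - a) (hy : 0 < y)
    (h2 : a * y ≤ b * x) (h3 : b * (x - 1) ≤ (a - 1) * y) (hyb : y < b) :
    0 < x - x ^ 2 - y ^ 2 + k * y := by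
  have h := mul_height_pos hb hy h2 h3 hyb
  have heq : b * (x - x ^ 2 - y ^ 2) + (a ^ 2 + b ^ 2 - a) * y =
      b * (x - x ^ 2 - y ^ 2 + k * y) := by
    rw [← hk]; ring
  rw [heq] at h
  exact pos_of_mul_pos_right h hb.le

/-- A point of the open triangle lies strictly between the lines `y = 0` and `y = b`. [folklore] -/
theorem lt_of_mem_triangle {a b x y : ℝ} (h2 : a * y < b * x) (h3 : b * (x - 1) < (a - 1) * y) :
    y < b := by
  nlinarith

/-! ### The innermost integral `∫_{t > √H} t⁻³ dt = 1/(2H)` -/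

/-- For `H > 0`, `∫_{√H}^∞ t⁻³ dt = 1/(2H)` (as a Lebesgue integral of `ofReal`).
[cite: Milnor1982, Appendix, proof of Lemma 2, p. 19] -/
theorem lintegral_Ioi_sqrt_one_div_cube {H : ℝ} (hH : 0 < H) :
    ∫⁻ t in Ioi (Real.sqrt H), ENNReal.ofReal (1 / t ^ 3) = ENNReal.ofReal (1 / (2 * H)) := by
  have hc : 0 < Real.sqrt H := Real.sqrt_pos.mpr hH
  have hcongr : EqOn (fun t : ℝ => t ^ (-3 : ℝ)) (fun t : ℝ => 1 / t ^ 3) (Ioi (Real.sqrt H)) := by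
    intro t ht
    have ht0 : 0 < t := hc.trans ht
    simp only
    rw [Real.rpow_neg ht0.le, show (3 : ℝ) = ((3 : ℕ) : ℝ) by norm_num, Real.rpow_natCast,
      one_div]
  have hint : IntegrableOn (fun t : ℝ => 1 / t ^ 3) (Ioi (Real.sqrt H)) :=
    (integrableOn_Ioi_rpow_of_lt (by norm_num : (-3 : ℝ) < -1) hc).congr_fun hcongr
      measurableSet_Ioi
  have hnn : 0 ≤ᵐ[volume.restrict (Ioi (Real.sqrt H))] fun t : ℝ => 1 / t ^ 3 := by
    rw [Filter.EventuallyLE, ae_restrict_iff' measurableSet_Ioi]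
    exact Filter.Eventually.of_forall fun t ht => by
      have ht0 : 0 < t := hc.trans ht
      positivity
  rw [← ofReal_integral_eq_lintegral_ofReal hint hnn]
  congr 1
  rw [← setIntegral_congr_fun measurableSet_Ioi hcongr,
    integral_Ioi_rpow_of_lt (by norm_num : (-3 : ℝ) < -1) hc]
  have h2 : Real.sqrt H ^ ((-3 : ℝ) + 1) = 1 / H := by
    rw [show (-3 : ℝ) + 1 = -2 by norm_num, Real.rpow_neg hc.le,
      show (2 : ℝ) = ((2 : ℕ) : ℝ) by norm_num, Real.rpow_natCast, Real.sq_sqrt hH.le, one_div]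
  rw [h2]
  field_simp
  norm_num

/-! ### Tonelli on `ℝ³`: the volume as a triple iterated integral -/

section Tonelli

variable {a b k : ℝ}

/-- The indicator of `T(z)` times `t⁻³`, evaluated at the point with coordinates `(x, y, t)`,
in the sliced form used below. [cite: Milnor1982, Appendix, proof of Lemma 2, p. 19] -/
theorem indicator_idealTetrahedron_apply {z : ℂ} (hb : 0 < z.im) (hk : z.im * k =
      z.re ^ 2 + z.im ^ 2 - z.re) (p : Fin 3 → ℝ) :
    (idealTetrahedron z).indicator (fun p : Fin 3 → ℝ => ENNReal.ofReal (1 / p 2 ^ 3)) p =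
      if 0 < p 1 ∧ z.re * p 1 < z.im * p 0 ∧ z.im * (p 0 - 1) < (z.re - 1) * p 1 then
        (Ioi (Real.sqrt (p 0 - p 0 ^ 2 - p 1 ^ 2 + k * p 1))).indicator
          (fun t : ℝ => ENNReal.ofReal (1 / t ^ 3)) (p 2)
      else 0 := by
  classical
  have hlast : (0 < p 2 ∧ 0 < z.im * (p 0 ^ 2 + p 1 ^ 2 + p 2 ^ 2 - p 0) +
      (z.re - Complex.normSq z) * p 1) ↔
        p 2 ∈ Ioi (Real.sqrt (p 0 - p 0 ^ 2 - p 1 ^ 2 + k * p 1)) := by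
    have hN : Complex.normSq z = z.re * z.re + z.im * z.im := Complex.normSq_apply z
    have heq : z.im * (p 0 ^ 2 + p 1 ^ 2 + p 2 ^ 2 - p 0) + (z.re - Complex.normSq z) * p 1 =
        z.im * (p 2 ^ 2 - (p 0 - p 0 ^ 2 - p 1 ^ 2 + k * p 1)) := by
      rw [hN]; linear_combination (p 1) * hk
    rw [heq, mem_Ioi]
    constructor
    · rintro ⟨ht, h⟩
      have h' : p 0 - p 0 ^ 2 - p 1 ^ 2 + k * p 1 < p 2 ^ 2 := by
        have := (mul_pos_iff_of_pos_left hb).mp h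
        linarith
      exact (Real.sqrt_lt' ht).mpr h'
    · intro h
      have ht : 0 < p 2 := (Real.sqrt_nonneg _).trans_lt h
      refine ⟨ht, mul_pos hb ?_⟩
      have := (Real.sqrt_lt' ht).mp h
      linarith
  by_cases htri : 0 < p 1 ∧ z.re * p 1 < z.im * p 0 ∧ z.im * (p 0 - 1) < (z.re - 1) * p 1
  · rw [if_pos htri]
    by_cases ht : p 2 ∈ Ioi (Real.sqrt (p 0 - p 0 ^ 2 - p 1 ^ 2 + k * p 1))
    · rw [indicator_of_mem ht, indicator_of_mem]
      exact ⟨htri.1, htri.2.1, htri.2.2, hlast.mpr ht⟩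
    · rw [indicator_of_notMem ht, indicator_of_notMem]
      intro hp
      exact ht (hlast.mp ⟨hp.2.2.2.1, hp.2.2.2.2⟩)
  · rw [if_neg htri, indicator_of_notMem]
    intro hp
    exact htri ⟨hp.1, hp.2.1, hp.2.2.1⟩

/-- The `x`-slice of the triangle at height `y ∈ (0, b)` is the interval
`(a y / b, 1 + (a − 1) y / b)`; outside `0 < y < b` it is empty. The middle integral of the
Tonelli computation. [cite: Milnor1982, Appendix, proof of Lemma 2, p. 19] -/
theorem lintegral_slice_x (hb : 0 < b) (hk : b * k = a ^ 2 + b ^ 2 - a) (y : ℝ) :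
    ∫⁻ x : ℝ, (if 0 < y ∧ a * y < b * x ∧ b * (x - 1) < (a - 1) * y then
        ENNReal.ofReal (1 / (2 * (x - x ^ 2 - y ^ 2 + k * y))) else 0) =
      (Ioo 0 b).indicator (fun y => ENNReal.ofReal
        (∫ x in (a * y / b)..(1 + (a - 1) * y / b), 1 / (2 * (x - x ^ 2 - y ^ 2 + k * y)))) y := by
  classical
  by_cases hy : y ∈ Ioo 0 b
  · rw [indicator_of_mem hy]
    have hslice : ∀ x : ℝ, (0 < y ∧ a * y < b * x ∧ b * (x - 1) < (a - 1) * y) ↔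
        x ∈ Ioo (a * y / b) (1 + (a - 1) * y / b) := by
      intro x
      rw [mem_Ioo]
      have e1 : a * y / b < x ↔ a * y < b * x := by
        rw [div_lt_iff₀ hb]; constructor <;> intro h <;> linarith
      have e2 : x < 1 + (a - 1) * y / b ↔ b * (x - 1) < (a - 1) * y := by
        rw [← sub_lt_iff_lt_add', lt_div_iff₀ hb]; constructor <;> intro h <;> linarith
      rw [e1, e2]
      exact ⟨fun h => ⟨h.2.1, h.2.2⟩, fun h => ⟨hy.1, h.1, h.2⟩⟩
    have hfun : (fun x : ℝ => if 0 < y ∧ a * y < b * x ∧ b * (x - 1) < (a - 1) * y then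
        ENNReal.ofReal (1 / (2 * (x - x ^ 2 - y ^ 2 + k * y))) else 0) =
        (Ioo (a * y / b) (1 + (a - 1) * y / b)).indicator
          (fun x => ENNReal.ofReal (1 / (2 * (x - x ^ 2 - y ^ 2 + k * y)))) := by
      funext x
      rw [indicator_apply]
      exact if_congr (hslice x) rfl rfl
    rw [hfun, lintegral_indicator measurableSet_Ioo]
    have hlt : a * y / b < 1 + (a - 1) * y / b := by
      rw [div_lt_iff₀ hb, add_mul, div_mul_cancel₀ _ hb.ne']
      nlinarith [hy.1, hy.2]
    have hpos : ∀ x ∈ Icc (a * y / b) (1 + (a - 1) * y / b),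
        0 < x - x ^ 2 - y ^ 2 + k * y := by
      intro x hx
      refine height_pos hb hk hy.1 ?_ ?_ hy.2
      · have := hx.1; rw [div_le_iff₀ hb] at this; linarith
      · have := hx.2; rw [← sub_le_iff_le_add', le_div_iff₀ hb] at this; linarith
    have hcont : ContinuousOn (fun x : ℝ => 1 / (2 * (x - x ^ 2 - y ^ 2 + k * y)))
        (Icc (a * y / b) (1 + (a - 1) * y / b)) := by
      refine ContinuousOn.div continuousOn_const (by fun_prop) fun x hx => ?_
      exact mul_ne_zero two_ne_zero (hpos x hx).ne'
    have hint : IntegrableOn (fun x : ℝ => 1 / (2 * (x - x ^ 2 - y ^ 2 + k * y)))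
        (Ioo (a * y / b) (1 + (a - 1) * y / b)) :=
      (hcont.integrableOn_Icc).mono_set Ioo_subset_Icc_self
    have hnn : 0 ≤ᵐ[volume.restrict (Ioo (a * y / b) (1 + (a - 1) * y / b))]
        fun x : ℝ => 1 / (2 * (x - x ^ 2 - y ^ 2 + k * y)) := by
      rw [Filter.EventuallyLE, ae_restrict_iff' measurableSet_Ioo]
      exact Filter.Eventually.of_forall fun x hx => by
        have := hpos x (Ioo_subset_Icc_self hx)
        positivity
    rw [← ofReal_integral_eq_lintegral_ofReal hint hnn, intervalIntegral.integral_of_le hlt.le,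
      integral_Ioc_eq_integral_Ioo]
  · rw [indicator_of_notMem hy]
    have hfun : (fun x : ℝ => if 0 < y ∧ a * y < b * x ∧ b * (x - 1) < (a - 1) * y then
        ENNReal.ofReal (1 / (2 * (x - x ^ 2 - y ^ 2 + k * y))) else 0) = fun _ => 0 := by
      funext x
      rw [if_neg]
      rintro ⟨h1, h2, h3⟩
      exact hy ⟨h1, lt_of_mem_triangle h2 h3⟩
    rw [hfun, lintegral_zero]

/-- The innermost integral of the Tonelli computation: over a point of the open triangle the
`t`-integral of `t⁻³` above the hemisphere is `1/(2H)`; elsewhere `0`.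
[cite: Milnor1982, Appendix, proof of Lemma 2, p. 19] -/
theorem lintegral_slice_t (hb : 0 < b) (hk : b * k = a ^ 2 + b ^ 2 - a) (x y : ℝ) :
    ∫⁻ t : ℝ, (if 0 < y ∧ a * y < b * x ∧ b * (x - 1) < (a - 1) * y then
        (Ioi (Real.sqrt (x - x ^ 2 - y ^ 2 + k * y))).indicator
          (fun t : ℝ => ENNReal.ofReal (1 / t ^ 3)) t
      else 0) =
      if 0 < y ∧ a * y < b * x ∧ b * (x - 1) < (a - 1) * y then
        ENNReal.ofReal (1 / (2 * (x - x ^ 2 - y ^ 2 + k * y))) else 0 := by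
  classical
  by_cases htri : 0 < y ∧ a * y < b * x ∧ b * (x - 1) < (a - 1) * y
  · simp only [if_pos htri]
    rw [lintegral_indicator measurableSet_Ioi]
    exact lintegral_Ioi_sqrt_one_div_cube
      (height_pos hb hk htri.1 htri.2.1.le htri.2.2.le (lt_of_mem_triangle htri.2.1 htri.2.2))
  · simp only [if_neg htri, lintegral_zero]

/-- **Tonelli for the ideal tetrahedron.** For `Im z > 0`, writing `z = a + bi`,
`k = (a² + b² − a)/b`:
`vol T(z) = (∫⁻_{y ∈ (0, b)} ofReal (∫_{a y/b}^{1 + (a−1) y/b} dx / (2(x − x² − y² + k y)))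
dy).toReal`
— the volume element `dx dy dt/t³` integrated first in `t` over `t > √H` (Milnor 1982, p. 19:
"Integrating with respect to z, we obtain ½ dx dy/(1 − x² − y²)", here for the hemisphere of
squared height `H`), then in `x` along horizontal slices of the triangle `(0, 1, z)`.
[cite: Milnor1982, Appendix, proof of Lemma 2, p. 19] -/
theorem idealTetrahedronVolume_eq_lintegral_slice {z : ℂ} (hb : 0 < z.im) {k : ℝ}
    (hk : z.im * k = z.re ^ 2 + z.im ^ 2 - z.re) :
    idealTetrahedronVolume z = (∫⁻ y in Ioo 0 z.im, ENNReal.ofReal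
      (∫ x in (z.re * y / z.im)..(1 + (z.re - 1) * y / z.im),
        1 / (2 * (x - x ^ 2 - y ^ 2 + k * y)))).toReal := by
  classical
  have hT := measurableSet_idealTetrahedron z
  -- Step 1: Bochner integral as a Lebesgue integral.
  have hmeas : Measurable fun p : Fin 3 → ℝ => 1 / p 2 ^ 3 := by fun_prop
  have hnn : 0 ≤ᵐ[volume.restrict (idealTetrahedron z)] fun p : Fin 3 → ℝ => 1 / p 2 ^ 3 := by
    rw [Filter.EventuallyLE, ae_restrict_iff' hT]
    exact Filter.Eventually.of_forall fun p hp => by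
      have := hp.2.2.2.1
      positivity
  unfold idealTetrahedronVolume
  rw [integral_eq_lintegral_of_nonneg_ae hnn hmeas.aestronglyMeasurable]
  congr 1
  -- Step 2: as an integral of the indicator over `ℝ³`, then `lmarginal`.
  rw [← lintegral_indicator hT]
  set F : (Fin 3 → ℝ) → ℝ≥0∞ :=
    (idealTetrahedron z).indicator fun p : Fin 3 → ℝ => ENNReal.ofReal (1 / p 2 ^ 3) with hF
  have hFm : Measurable F := (ENNReal.measurable_ofReal.comp hmeas).indicator hT
  have huniv : (Finset.univ : Finset (Fin 3)) = insert 1 (insert 0 {2}) := by decide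
  rw [volume_pi, lintegral_eq_lmarginal_univ (fun _ => (0 : ℝ)), huniv,
    lmarginal_insert _ hFm (by decide), ← lintegral_indicator measurableSet_Ioo]
  refine lintegral_congr fun y => ?_
  rw [lmarginal_insert _ hFm (by decide)]
  -- the function of `y` on the right is the indicator computed by `lintegral_slice_x`
  rw [show (Ioo 0 z.im).indicator (fun y => ENNReal.ofReal
      (∫ x in (z.re * y / z.im)..(1 + (z.re - 1) * y / z.im),
        1 / (2 * (x - x ^ 2 - y ^ 2 + k * y)))) y =
      ∫⁻ x : ℝ, (if 0 < y ∧ z.re * y < z.im * x ∧ z.im * (x - 1) < (z.re - 1) * y then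
        ENNReal.ofReal (1 / (2 * (x - x ^ 2 - y ^ 2 + k * y))) else 0) from
    (lintegral_slice_x hb hk y).symm]
  refine lintegral_congr fun x => ?_
  rw [lmarginal_singleton, ← lintegral_slice_t hb hk x y]
  refine lintegral_congr fun t => ?_
  rw [hF, indicator_idealTetrahedron_apply hb hk]
  simp [Function.update_self, Function.update_of_ne]

end Tonelli

/-! ### The slice integral in closed form -/

section SliceValue

variable {a b k : ℝ}

/-- If `A·B > 0` and `A + B > 0` then `A > 0` (and symmetrically `B > 0`). [folklore] -/
theorem pos_of_mul_pos_of_add_pos {A B : ℝ} (h1 : 0 < A * B) (h2 : 0 < A + B) : 0 < A := by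
  rcases lt_or_ge 0 A with hA | hA
  · exact hA
  · exfalso
    have hB : 0 < B := by linarith
    nlinarith

/-- **The horizontal slice integral in closed form** (Milnor 1982, p. 19: "Integrating with
respect to y, we obtain `∫ (1/4A) log((A + x tan α)/(A − x tan α)) dx`", here for slices parallel
to the edge `[0, 1]`): for `0 < y < b`, with `ρ = √(¼ + k y − y²)` the half-length of the chord of
the circumcircle at height `y` (so `H(x, y) = ρ² − (x − ½)²`),
`∫_{a y/b}^{1 + (a−1)y/b} dx/(2H) = (1/4ρ) · log(((ρ + ½)² + y²)/((ρ − ½)² + y²))`.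
The primitive is `(1/4ρ)(log(ρ − ½ + x) − log(ρ + ½ − x))`; the evaluation at the two edges
`[0, z]`, `[1, z]` collapses, by the intersecting-chords identity
`(ρ−½+x_R)(ρ+½−x_L)((ρ−½)²+y²) = (ρ+½−x_R)(ρ−½+x_L)((ρ+½)²+y²)`, to squared distances from the
chord's endpoints `(½ ∓ ρ, y)` to the vertex `1` — the terms belonging to the vertex `z` cancel.
[cite: Milnor1982, Appendix, proof of Lemma 2, pp. 19–20] -/
theorem slice_integral_eq (hb : 0 < b) (hk : b * k = a ^ 2 + b ^ 2 - a) {y : ℝ} (hy : 0 < y)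
    (hyb : y < b) :
    ∫ x in (a * y / b)..(1 + (a - 1) * y / b), 1 / (2 * (x - x ^ 2 - y ^ 2 + k * y)) =
      1 / (4 * Real.sqrt (1 / 4 + k * y - y ^ 2)) *
        Real.log (((Real.sqrt (1 / 4 + k * y - y ^ 2) + 1 / 2) ^ 2 + y ^ 2) /
          ((Real.sqrt (1 / 4 + k * y - y ^ 2) - 1 / 2) ^ 2 + y ^ 2)) := by
  set ρ := Real.sqrt (1 / 4 + k * y - y ^ 2) with hρdef
  set xL := a * y / b with hxL
  set xR := 1 + (a - 1) * y / b with hxR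
  have hbxL : b * xL = a * y := by rw [hxL]; field_simp
  have hbxR : b * xR = b + (a - 1) * y := by rw [hxR]; field_simp
  have hlt : xL < xR := by
    have : b * xL < b * xR := by rw [hbxL, hbxR]; nlinarith
    exact lt_of_mul_lt_mul_left this hb.le
  have hpos : ∀ x ∈ Icc xL xR, 0 < x - x ^ 2 - y ^ 2 + k * y := by
    intro x hx
    refine height_pos hb hk hy ?_ ?_ hyb
    · have := mul_le_mul_of_nonneg_left hx.1 hb.le; linarith
    · have := mul_le_mul_of_nonneg_left hx.2 hb.le; linarith
  have hρ2pos : 0 < 1 / 4 + k * y - y ^ 2 := by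
    have h0 := hpos xL (left_mem_Icc.mpr hlt.le)
    have h1 : (xL - 1 / 2) ^ 2 = xL ^ 2 - xL + 1 / 4 := by ring
    nlinarith [sq_nonneg (xL - 1 / 2)]
  have hρsq : ρ ^ 2 = 1 / 4 + k * y - y ^ 2 := Real.sq_sqrt hρ2pos.le
  have hρpos : 0 < ρ := Real.sqrt_pos.mpr hρ2pos
  have hH : ∀ x, x - x ^ 2 - y ^ 2 + k * y = (ρ - 1 / 2 + x) * (ρ + 1 / 2 - x) := by
    intro x; nlinarith [hρsq]
  have hA : ∀ x ∈ Icc xL xR, 0 < ρ - 1 / 2 + x := fun x hx =>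
    pos_of_mul_pos_of_add_pos (by rw [← hH]; exact hpos x hx) (by linarith)
  have hB : ∀ x ∈ Icc xL xR, 0 < ρ + 1 / 2 - x := fun x hx =>
    pos_of_mul_pos_of_add_pos (by rw [mul_comm, ← hH]; exact hpos x hx) (by linarith)
  -- the primitive
  have hderiv : ∀ x ∈ uIcc xL xR, HasDerivAt
      (fun x => 1 / (4 * ρ) * (Real.log (ρ - 1 / 2 + x) - Real.log (ρ + 1 / 2 - x)))
      (1 / (2 * (x - x ^ 2 - y ^ 2 + k * y))) x := by
    intro x hx
    rw [uIcc_of_le hlt.le] at hx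
    have hAx := hA x hx
    have hBx := hB x hx
    have h1 : HasDerivAt (fun x => ρ - 1 / 2 + x) 1 x := (hasDerivAt_id x).const_add _
    have h2 : HasDerivAt (fun x => ρ + 1 / 2 - x) (-1) x := (hasDerivAt_id x).const_sub _
    have h := ((h1.log hAx.ne').sub (h2.log hBx.ne')).const_mul (1 / (4 * ρ))
    refine h.congr_deriv ?_
    have hA0 : ρ - 1 / 2 + x ≠ 0 := hAx.ne'
    have hB0 : ρ + 1 / 2 - x ≠ 0 := hBx.ne'
    have hρ0 : ρ ≠ 0 := hρpos.ne'
    rw [hH x, div_sub_div _ _ hA0 hB0, one_div_mul_eq_div, div_div, div_eq_div_iff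
      (mul_ne_zero (mul_ne_zero hA0 hB0) (mul_ne_zero (by norm_num) hρ0))
      (mul_ne_zero two_ne_zero (mul_ne_zero hA0 hB0))]
    ring
  have hcont : ContinuousOn (fun x : ℝ => 1 / (2 * (x - x ^ 2 - y ^ 2 + k * y)))
      (uIcc xL xR) := by
    rw [uIcc_of_le hlt.le]
    refine ContinuousOn.div continuousOn_const (by fun_prop) fun x hx => ?_
    exact mul_ne_zero two_ne_zero (hpos x hx).ne'
  rw [intervalIntegral.integral_eq_sub_of_hasDerivAt hderiv (hcont.intervalIntegrable)]
  -- evaluation: the intersecting-chords identity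
  have hxLmem : xL ∈ Icc xL xR := left_mem_Icc.mpr hlt.le
  have hxRmem : xR ∈ Icc xL xR := right_mem_Icc.mpr hlt.le
  have hAR := hA xR hxRmem
  have hBR := hB xR hxRmem
  have hAL := hA xL hxLmem
  have hBL := hB xL hxLmem
  have hE : 0 < (ρ + 1 / 2) ^ 2 + y ^ 2 := by positivity
  have hF : 0 < (ρ - 1 / 2) ^ 2 + y ^ 2 := by positivity
  have key : (ρ - 1 / 2 + xR) * (ρ + 1 / 2 - xL) * ((ρ - 1 / 2) ^ 2 + y ^ 2) =
      (ρ + 1 / 2 - xR) * (ρ - 1 / 2 + xL) * ((ρ + 1 / 2) ^ 2 + y ^ 2) := by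
    have hREL : b * ρ ^ 2 - b / 4 - (a ^ 2 + b ^ 2 - a) * y + b * y ^ 2 = 0 := by
      rw [hρsq, ← hk]; ring
    have key' : (b * ρ + (b / 2 + (a - 1) * y)) * (b * ρ - (a * y - b / 2)) *
        ((ρ - 1 / 2) ^ 2 + y ^ 2) = (b * ρ - (b / 2 + (a - 1) * y)) * (b * ρ + (a * y - b / 2)) *
        ((ρ + 1 / 2) ^ 2 + y ^ 2) := by
      linear_combination (-2 * ρ * y) * hREL
    have e1 : b * ρ + (b / 2 + (a - 1) * y) = b * (ρ - 1 / 2 + xR) := by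
      rw [mul_add, mul_sub, hbxR]; ring
    have e2 : b * ρ - (a * y - b / 2) = b * (ρ + 1 / 2 - xL) := by
      rw [mul_sub, mul_add, hbxL]; ring
    have e3 : b * ρ - (b / 2 + (a - 1) * y) = b * (ρ + 1 / 2 - xR) := by
      rw [mul_sub, mul_add, hbxR]; ring
    have e4 : b * ρ + (a * y - b / 2) = b * (ρ - 1 / 2 + xL) := by
      rw [mul_add, mul_sub, hbxL]; ring
    rw [e1, e2, e3, e4] at key'
    have hb2 : (0 : ℝ) < b ^ 2 := by positivity
    have : b ^ 2 * ((ρ - 1 / 2 + xR) * (ρ + 1 / 2 - xL) * ((ρ - 1 / 2) ^ 2 + y ^ 2)) =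
        b ^ 2 * ((ρ + 1 / 2 - xR) * (ρ - 1 / 2 + xL) * ((ρ + 1 / 2) ^ 2 + y ^ 2)) := by
      linear_combination key'
    exact mul_left_cancel₀ hb2.ne' this
  have hlog : Real.log (ρ - 1 / 2 + xR) - Real.log (ρ + 1 / 2 - xR) -
      (Real.log (ρ - 1 / 2 + xL) - Real.log (ρ + 1 / 2 - xL)) =
      Real.log (((ρ + 1 / 2) ^ 2 + y ^ 2) / ((ρ - 1 / 2) ^ 2 + y ^ 2)) := by
    have h3 : Real.log ((ρ - 1 / 2 + xR) * (ρ + 1 / 2 - xL) * ((ρ - 1 / 2) ^ 2 + y ^ 2)) =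
        Real.log ((ρ + 1 / 2 - xR) * (ρ - 1 / 2 + xL) * ((ρ + 1 / 2) ^ 2 + y ^ 2)) := by
      rw [key]
    rw [Real.log_mul (by positivity) hF.ne', Real.log_mul hAR.ne' hBL.ne',
      Real.log_mul (by positivity) hE.ne', Real.log_mul hBR.ne' hAL.ne'] at h3
    rw [Real.log_div hE.ne' hF.ne']
    linarith
  rw [← hlog]
  ring

end SliceValue

end Literature.NumberTheory.Transcendental

end
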